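import Literature.NumberTheory.GaloisRepresentations.DivisorClassGaloisAction
import Literature.NumberTheory.DiophantineGeometry.FunctionFieldResidues
import Literature.LinearAlgebra.Semilinear.FrobeniusSemilinearFixedPoints
import HarnessLib

/-!
# Frobenius-invariant effective divisors and invariant divisor classes of a function field over `k̄`

Topic `Literature/NumberTheory/GaloisRepresentations`; **proof file** (theorems only; D-0014/D-0026:
no definitions, no named facts).

**Setting.** `F/Ω` is an algebraic function field of one variable over an ALGEBRAICALLY CLOSED field
`Ω` (so every place is rational), a group `G` acts on `F` by ring automorphisms stabilising `Ω`
(`IsConstantStable`, file `DivisorClassGaloisAction`: hence `G` acts on places, divisors —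
`Finsupp.comapDistribMulAction` — and divisor classes — `divisorClassDistribMulAction`, both switched
on locally), and `σ ∈ G` acts on the constants as a `q`-FROBENIUS: `σ c = c^q` for `q = #k` the
cardinality of a finite field `k ⊆ Ω`.  The example is `F = Ω(C)` for a curve `C` over `𝔽_q`,
`Ω = 𝔽̄_q`, `σ = φ^r` a power of the Frobenius of `Gal(Ω/𝔽_q)` acting through the coefficients
(`SuperellipticFunctionField`), `k = 𝔽_{q^r}`.

**Results** (the divisor-theoretic half of Weil's determination of `#J(𝔽_{q^r})`, Milne,
*Jacobian varieties* §11 / Stichtenoth §5.1 run for `σ`-INVARIANT divisors of `F/Ω` instead of the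
divisors of `F^σ/k`):

* `exists_semilinear_of_smul_eq_add` — for a divisor `D₀` whose CLASS is `σ`-invariant,
  `σ D₀ = D₀ + (g)`, the map `Φ u = g · σ(u)` is an injective `q`-Frobenius-semilinear endomorphism
  of the Riemann–Roch space `ℒ(D₀)`.
* `natCard_invariant_effective_mul` — **the `σ`-invariant positive divisors in the class of `D₀` number
  `(q^{ℓ(D₀)} - 1)/(q - 1)`**: they are the `(u) + D₀` with `Ω u` a `Φ`-stable line, and the stable lines
  of an injective `q`-semilinear map of an `m`-dimensional `Ω`-space are in bijection with `ℙ^{m-1}(k)`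
  (Lang's theorem for `GL_m`, file `FrobeniusSemilinearFixedPoints`).  In particular an invariant class
  with `ℓ ≥ 1` CONTAINS an invariant positive divisor (`exists_invariant_effective`; this is Hilbert 90 /
  Lang for the class, obtained here for free), and these sets are finite (`finite_invariant_effective`).
* `natCard_invariantClasses_eq` — adding `n P₀` for a `σ`-fixed place `P₀` identifies the invariant
  classes of degree `0` with those of degree `n` (`h^σ := #{c : deg c = 0, σ c = c}`).
* `natCard_invariant_effective_degree_mul` — **`A_n^σ (q - 1) = h^σ (q^{n+1-g} - 1)` for `n > 2g - 2`**,
  where `A_n^σ = #{A ≥ 0 : σ A = A, deg A = n}` (sum over the invariant classes of degree `n`, each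
  contributing `(q^{n+1-g} - 1)/(q - 1)` by Riemann–Roch), provided `A_n^σ` is finite; and the invariant
  classes of every degree are then finite (`finite_invariantClasses`).

The zeta function `∑ A_n^σ t^n` of the pair `(F, σ)`, its Euler product over the `σ`-orbits of places
and the resulting formula for `h^σ` are in the sequel `FrobeniusPairZeta`.

## References
* J. S. Milne, *Jacobian varieties*, in: Arithmetic Geometry (Cornell–Silverman eds.), Springer (1986),
  §11, proof of Thm. 11.1. [Milne1986JacobianVarieties]
* H. Stichtenoth, *Algebraic Function Fields and Codes*, 2nd ed., GTM 254 (2009), Lemma 5.1.4,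
  Prop. 5.1.3, §5.2 (proof of Prop. 5.2.6/5.2.8 by Galois descent). [Stichtenoth2009]
* S. Lang, *Algebraic groups over finite fields*, Amer. J. Math. 78 (1956), Thm. 1 and Cor.
  (as in `FrobeniusSemilinearFixedPoints`). [cite: SpringerLAG1998, Thm. 4.4.17]
-/

noncomputable section

open scoped Classical

namespace Literature.NumberTheory.GaloisRepresentations

open Literature.NumberTheory.DiophantineGeometry Literature.NumberTheory.DiophantineGeometry.AlgFunctionField
  Literature.LinearAlgebra.Semilinear Literature.NumberTheory.Automorphic

universe u v w x

attribute [local instance] Finsupp.comapSMul Finsupp.comapMulAction Finsupp.comapDistribMulAction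
attribute [local instance] divisorClassDistribMulAction

variable {Ω : Type u} {F : Type v} [Field Ω] [Field F] [Algebra Ω F]
variable {G : Type w} [Group G] [MulSemiringAction G F] [IsConstantStable G Ω F]

/-! ### The action on divisors: positivity and linear equivalence are preserved -/

section Basic

variable [IsAlgFunctionField Ω F]

omit [IsAlgFunctionField Ω F] in
/-- `σ` preserves positivity of divisors (`(σ A)(v) = A(σ⁻¹ v)`). [folklore] -/
theorem smul_divisor_nonneg (σ : G) {A : Divisor Ω F} (hA : 0 ≤ A) : 0 ≤ σ • A := fun v => by
  rw [smul_divisor_apply]; exact hA _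

omit [IsAlgFunctionField Ω F] in
/-- `0 ≤ σ A ↔ 0 ≤ A`. [folklore] -/
theorem smul_divisor_nonneg_iff (σ : G) {A : Divisor Ω F} : 0 ≤ σ • A ↔ 0 ≤ A :=
  ⟨fun h => by simpa using smul_divisor_nonneg σ⁻¹ h, smul_divisor_nonneg σ⟩

/-- An invariant class: `σ [D₀] = [D₀]` iff `σ D₀ = D₀ + (g)` for some `g ≠ 0`. [folklore] -/
theorem smul_mk_eq_mk_iff (σ : G) (D₀ : Divisor Ω F) :
    σ • DivisorClass.mk D₀ = DivisorClass.mk D₀ ↔ ∃ g : F, g ≠ 0 ∧ σ • D₀ = D₀ + principalDivisor Ω g := by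
  rw [smul_divisorClassMk, DivisorClass.mk_eq_mk_iff]
  constructor
  · rintro ⟨g, hg0, hg⟩
    exact ⟨g, hg0, by rw [hg, add_sub_cancel]⟩
  · rintro ⟨g, hg0, hg⟩
    exact ⟨g, hg0, by rw [hg, add_sub_cancel_left]⟩

end Basic

/-! ### The Frobenius-semilinear endomorphism `u ↦ g σ(u)` of `ℒ(D₀)` -/

section Semilinear

variable [IsAlgFunctionField Ω F] [IsIntegrallyClosedIn Ω F]
variable {k : Type x} [Field k] [Finite k] [Algebra k Ω]
variable {σ : G} (hσ : ∀ c : Ω, σ • algebraMap Ω F c = algebraMap Ω F (c ^ Nat.card k))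

include hσ

omit [IsConstantStable G Ω F] [IsAlgFunctionField Ω F] [IsIntegrallyClosedIn Ω F] [Field k] [Finite k]
  [Algebra k Ω] in
/-- `σ (c • u) = c^q • σ u` on `F`. [folklore] -/
theorem smul_smul_eq_pow_smul (c : Ω) (u : F) : σ • (c • u) = (c ^ Nat.card k) • σ • u := by
  rw [Algebra.smul_def, smul_mul', hσ, ← Algebra.smul_def]

omit [IsIntegrallyClosedIn Ω F] in
/-- **`Φ u = g · σ(u)` is an injective `q`-Frobenius-semilinear endomorphism of `ℒ(D₀)`** when
`σ D₀ = D₀ + (g)`, `g ≠ 0`: for `0 ≠ u ∈ ℒ(D₀)`, `(σ u) + σ D₀ ≥ 0`, i.e. `(g σ u) + D₀ ≥ 0`.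
[cite: Stichtenoth2009, Lemma 5.1.4 (b)] [cite: Milne1986JacobianVarieties, §11] -/
theorem exists_semilinear_of_smul_eq_add (D₀ : Divisor Ω F) {g : F} (hg0 : g ≠ 0)
    (hg : σ • D₀ = D₀ + principalDivisor Ω g) :
    ∃ Φ : riemannRochSpace (K := Ω) D₀ →ₛₗ[qFrobenius k Ω] riemannRochSpace (K := Ω) D₀,
      Function.Injective Φ ∧ ∀ u, (Φ u : F) = g * σ • (u : F) := by
  have hmem : ∀ u : F, u ∈ riemannRochSpace (K := Ω) D₀ → g * σ • u ∈ riemannRochSpace (K := Ω) D₀ := by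
    intro u hu
    rcases eq_or_ne u 0 with rfl | hu0
    · rw [smul_zero, mul_zero]; exact zero_mem _
    have hσu0 : σ • u ≠ 0 := (smul_ne_zero_iff_ne σ).2 hu0
    rw [mem_riemannRochSpace_iff_nonneg D₀ (mul_ne_zero hg0 hσu0), principalDivisor_mul hg0 hσu0,
      ← smul_principalDivisor, add_assoc, add_comm, add_assoc, ← hg, ← smul_add]
    exact smul_divisor_nonneg σ ((mem_riemannRochSpace_iff_nonneg D₀ hu0).1 hu)
  refine ⟨{ toFun := fun u => ⟨g * σ • (u : F), hmem u u.2⟩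
            map_add' := fun u u' => Subtype.ext (by simp [smul_add, mul_add])
            map_smul' := fun c u => Subtype.ext ?_ }, ?_, fun u => rfl⟩
  · change g * σ • (c • (u : F)) = qFrobenius k Ω c • (g * σ • (u : F))
    rw [smul_smul_eq_pow_smul hσ, qFrobenius_apply, Algebra.smul_def, Algebra.smul_def, mul_left_comm]
  · intro u u' h
    have h' : g * σ • (u : F) = g * σ • (u' : F) := congrArg Subtype.val h
    exact Subtype.ext (smul_left_cancel σ (mul_left_cancel₀ hg0 h'))

/-- **The `σ`-invariant positive divisors in an invariant class number `(q^{ℓ} - 1)/(q - 1)`.**  Let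
`σ D₀ = D₀ + (g)` (`g ≠ 0`; i.e. the class `[D₀]` is `σ`-invariant).  Then
`(q - 1) · #{A ≥ 0 : A ∼ D₀, σ A = A} = q^{ℓ(D₀)} - 1`: such `A` are the `(u) + D₀`, `0 ≠ u ∈ ℒ(D₀)`, with
`(g σ u) = (u)`, i.e. with `Ω u` a line stable under `Φ = g σ` (`exists_semilinear_of_smul_eq_add`), and
the `Φ`-stable lines are counted by `sub_one_mul_natCard_eigenLine` (Lang's theorem for `GL_m`).
[cite: Stichtenoth2009, Lemma 5.1.4 (b)] [cite: Milne1986JacobianVarieties, §11 (proof of Thm. 11.1)]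
[cite: SpringerLAG1998, Thm. 4.4.17] -/
theorem natCard_invariant_effective_mul [IsAlgClosed Ω] (D₀ : Divisor Ω F) {g : F} (hg0 : g ≠ 0)
    (hg : σ • D₀ = D₀ + principalDivisor Ω g) :
    ((Nat.card k : ℤ) - 1) *
        Nat.card {A : Divisor Ω F // 0 ≤ A ∧ A.IsLinearlyEquivalent D₀ ∧ σ • A = A} =
      (Nat.card k : ℤ) ^ ell (K := Ω) D₀ - 1 := by
  set L := riemannRochSpace (K := Ω) D₀ with hL
  haveI : FiniteDimensional Ω L := finiteDimensional_riemannRochSpace_of_isAlgFunctionField D₀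
  obtain ⟨Φ, hΦ, hΦapply⟩ := exists_semilinear_of_smul_eq_add (k := k) hσ D₀ hg0 hg
  -- an eigenvector `u` of `Φ` (`Φ u = c u`) has `(g σ u) = (u)`, and conversely
  have key1 : ∀ {u : L}, u ≠ 0 → ((∃ c : Ω, Φ u = c • u) ↔
      principalDivisor Ω (g * σ • (u : F)) = principalDivisor Ω (u : F)) := by
    intro u hu0
    have hu0' : (u : F) ≠ 0 := fun h => hu0 (Subtype.ext h)
    constructor
    · rintro ⟨c, hc⟩
      have hc0 : c ≠ 0 := by
        rintro rfl
        rw [zero_smul, ← map_zero Φ] at hc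
        exact hu0 (hΦ hc)
      have h1 : g * σ • (u : F) = c • (u : F) := by rw [← hΦapply, hc]; rfl
      rw [h1, principalDivisor_smul hc0 hu0']
    · intro h
      have hgu0 : g * σ • (u : F) ≠ 0 := mul_ne_zero hg0 ((smul_ne_zero_iff_ne σ).2 hu0')
      have h2 : principalDivisor Ω (g * σ • (u : F) * (u : F)⁻¹) = 0 := by
        rw [principalDivisor_mul hgu0 (inv_ne_zero hu0'), principalDivisor_inv hu0', h, add_neg_cancel]
      obtain ⟨c, hc0, hc⟩ := exists_eq_algebraMap_of_principalDivisor_eq_zero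
        (mul_ne_zero hgu0 (inv_ne_zero hu0')) h2
      refine ⟨c, Subtype.ext ?_⟩
      rw [hΦapply]
      change g * σ • (u : F) = c • (u : F)
      rw [Algebra.smul_def, hc, inv_mul_cancel_right₀ hu0']
  -- `σ ((u) + D₀) = (g σ u) + D₀`
  have key2 : ∀ u : F, u ≠ 0 → σ • (principalDivisor Ω u + D₀) = principalDivisor Ω (g * σ • u) + D₀ := by
    intro u hu0
    rw [smul_add, smul_principalDivisor, hg, principalDivisor_mul hg0 ((smul_ne_zero_iff_ne σ).2 hu0)]
    abel
  -- the map from eigenlines to invariant positive divisors in the class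
  set S := {A : Divisor Ω F // 0 ≤ A ∧ A.IsLinearlyEquivalent D₀ ∧ σ • A = A} with hS
  have hgen : ∀ l : EigenLine Φ, ∃ u : L, u ≠ 0 ∧ (∃ c : Ω, Φ u = c • u) ∧ l.1 = Ω ∙ u := fun l => l.2
  choose gen hgen0 hgenE hgenL using hgen
  have hgen0' : ∀ l, ((gen l : L) : F) ≠ 0 := fun l h => hgen0 l (Subtype.ext h)
  let e : EigenLine Φ → S := fun l =>
    ⟨principalDivisor Ω ((gen l : L) : F) + D₀,
      (mem_riemannRochSpace_iff_nonneg D₀ (hgen0' l)).1 (gen l).2,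
      ⟨((gen l : L) : F), hgen0' l, by rw [add_sub_cancel_right]⟩,
      by rw [key2 _ (hgen0' l), (key1 (hgen0 l)).1 (hgenE l)]⟩
  have he : ∀ l, (e l).1 = principalDivisor Ω ((gen l : L) : F) + D₀ := fun l => rfl
  have hebij : Function.Bijective e := by
    constructor
    · intro l l' h
      have h1 : principalDivisor Ω ((gen l : L) : F) = principalDivisor Ω ((gen l' : L) : F) :=
        add_right_cancel ((he l).symm.trans ((congrArg Subtype.val h).trans (he l')))
      have h2 : principalDivisor Ω (((gen l : L) : F) * ((gen l' : L) : F)⁻¹) = 0 := by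
        rw [principalDivisor_mul (hgen0' l) (inv_ne_zero (hgen0' l')), principalDivisor_inv (hgen0' l'), h1,
          add_neg_cancel]
      obtain ⟨c, hc0, hc⟩ := exists_eq_algebraMap_of_principalDivisor_eq_zero
        (mul_ne_zero (hgen0' l) (inv_ne_zero (hgen0' l'))) h2
      have h3 : (gen l : L) = c • gen l' := Subtype.ext (by
        change ((gen l : L) : F) = c • ((gen l' : L) : F)
        rw [Algebra.smul_def, hc, inv_mul_cancel_right₀ (hgen0' l')])
      apply Subtype.ext
      rw [hgenL l, hgenL l', h3]
      exact Submodule.span_singleton_smul_eq (IsUnit.mk0 c hc0) _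
    · rintro ⟨A, hA, ⟨x, hx0, hxA⟩, hσA⟩
      have hxL : x ∈ L := by
        rw [hL, mem_riemannRochSpace_iff_nonneg D₀ hx0, hxA, sub_add_cancel]; exact hA
      have hxL0 : (⟨x, hxL⟩ : L) ≠ 0 := fun h => hx0 (congrArg Subtype.val h)
      have hAx : A = principalDivisor Ω x + D₀ := by rw [hxA, sub_add_cancel]
      have hE : ∃ c : Ω, Φ ⟨x, hxL⟩ = c • ⟨x, hxL⟩ := by
        rw [key1 hxL0]
        have h := hσA
        rw [hAx, key2 x hx0] at h
        exact add_right_cancel h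
      let l : EigenLine Φ := ⟨Ω ∙ (⟨x, hxL⟩ : L), ⟨x, hxL⟩, hxL0, hE, rfl⟩
      refine ⟨l, Subtype.ext ?_⟩
      rw [he]
      change principalDivisor Ω ((gen l : L) : F) + D₀ = A
      rw [hAx]
      -- `gen l` spans the same line as `x`
      have hspan : (Ω ∙ gen l) = Ω ∙ (⟨x, hxL⟩ : L) := (hgenL l).symm
      rw [Submodule.span_singleton_eq_span_singleton] at hspan
      obtain ⟨c, hc⟩ := hspan
      have hc' : x = (c : Ω) • ((gen l : L) : F) := by
        change ((⟨x, hxL⟩ : L) : F) = _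
        rw [← hc]; rfl
      rw [hc', principalDivisor_smul c.ne_zero (hgen0' l)]
  rw [← Nat.card_congr (Equiv.ofBijective e hebij), sub_one_mul_natCard_eigenLine Φ hΦ]
  rfl

/-- **Finiteness**: the `σ`-invariant positive divisors in an invariant class form a finite set (they inject
into the finitely many `Φ`-stable lines). [folklore] -/
theorem finite_invariant_effective [IsAlgClosed Ω] (D₀ : Divisor Ω F) {g : F} (hg0 : g ≠ 0)
    (hg : σ • D₀ = D₀ + principalDivisor Ω g) :
    Finite {A : Divisor Ω F // 0 ≤ A ∧ A.IsLinearlyEquivalent D₀ ∧ σ • A = A} := by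
  have hq : (1 : ℤ) < Nat.card k := by exact_mod_cast Finite.one_lt_card (α := k)
  by_contra hinf
  rw [not_finite_iff_infinite] at hinf
  haveI := hinf
  have h := natCard_invariant_effective_mul (k := k) hσ D₀ hg0 hg
  rw [Nat.card_eq_zero_of_infinite (α := {A : Divisor Ω F // 0 ≤ A ∧ A.IsLinearlyEquivalent D₀ ∧ σ • A = A}),
    Nat.cast_zero, mul_zero] at h
  have h1 : (1 : ℤ) ≤ (Nat.card k : ℤ) ^ ell (K := Ω) D₀ := one_le_pow₀ hq.le
  -- `q^ℓ - 1 = 0` forces `ℓ = 0`, but then `ℒ(D₀) = 0` has no lines: the set is empty, not infinite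
  have hℓ : ell (K := Ω) D₀ = 0 := by
    by_contra hne
    have : (Nat.card k : ℤ) < (Nat.card k : ℤ) ^ ell (K := Ω) D₀ + 1 := by
      calc (Nat.card k : ℤ) = (Nat.card k : ℤ) ^ 1 := (pow_one _).symm
        _ ≤ (Nat.card k : ℤ) ^ ell (K := Ω) D₀ := pow_le_pow_right₀ hq.le (Nat.one_le_iff_ne_zero.2 hne)
        _ < _ := lt_add_one _
    linarith
  obtain ⟨⟨A, hA, ⟨x, hx0, hxA⟩, -⟩⟩ := hinf.nonempty
  have hxL : x ∈ riemannRochSpace (K := Ω) D₀ := by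
    rw [mem_riemannRochSpace_iff_nonneg D₀ hx0, hxA, sub_add_cancel]; exact hA
  haveI : FiniteDimensional Ω (riemannRochSpace (K := Ω) D₀) :=
    finiteDimensional_riemannRochSpace_of_isAlgFunctionField D₀
  have h0 : riemannRochSpace (K := Ω) D₀ = ⊥ := Submodule.finrank_eq_zero.1 hℓ
  rw [h0, Submodule.mem_bot] at hxL
  exact hx0 hxL

/-- **An invariant class with `ℓ ≥ 1` contains an invariant positive divisor** (Lang's theorem replaces
Hilbert 90 in the constant field extension `F/F^σ`). [cite: Milne1986JacobianVarieties, §11] -/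
theorem exists_invariant_effective [IsAlgClosed Ω] (D₀ : Divisor Ω F) {g : F} (hg0 : g ≠ 0)
    (hg : σ • D₀ = D₀ + principalDivisor Ω g) (hℓ : 0 < ell (K := Ω) D₀) :
    ∃ A : Divisor Ω F, 0 ≤ A ∧ A.IsLinearlyEquivalent D₀ ∧ σ • A = A := by
  have hq : (1 : ℤ) < Nat.card k := by exact_mod_cast Finite.one_lt_card (α := k)
  have h := natCard_invariant_effective_mul (k := k) hσ D₀ hg0 hg
  have hpos : (0 : ℤ) < (Nat.card k : ℤ) ^ ell (K := Ω) D₀ - 1 := by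
    have : (Nat.card k : ℤ) ^ 1 ≤ (Nat.card k : ℤ) ^ ell (K := Ω) D₀ := pow_le_pow_right₀ hq.le hℓ
    rw [pow_one] at this
    linarith
  rw [← h] at hpos
  have hne : Nat.card {A : Divisor Ω F // 0 ≤ A ∧ A.IsLinearlyEquivalent D₀ ∧ σ • A = A} ≠ 0 := by
    intro h0; rw [h0, Nat.cast_zero, mul_zero] at hpos; exact lt_irrefl _ hpos
  obtain ⟨⟨A, hA⟩⟩ := (Nat.card_ne_zero.1 hne).1
  exact ⟨A, hA⟩

end Semilinear

/-! ### Invariant classes: shifting by a fixed place -/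

section Classes

variable [IsAlgFunctionField Ω F] [IsAlgClosed Ω]

/-- **`h^σ` does not depend on the degree**: for a `σ`-fixed place `P₀` (rational, as `Ω` is algebraically
closed), `c ↦ c + n [P₀]` is a bijection from the invariant classes of degree `0` onto those of degree `n`.
[cite: Stichtenoth2009, Prop. 5.1.3 (proof)] -/
theorem natCard_invariantClasses_eq (σ : G) {P₀ : PlaceOver Ω F} (hP₀ : σ • P₀ = P₀) (n : ℤ) :
    Nat.card {c : DivisorClass Ω F // DivisorClass.degree c = n ∧ σ • c = c} =
      Nat.card {c : DivisorClass Ω F // DivisorClass.degree c = 0 ∧ σ • c = c} := by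
  set c₀ : DivisorClass Ω F := DivisorClass.mk (Finsupp.single P₀ 1) with hc₀
  have hdeg₀ : DivisorClass.degree c₀ = 1 := by
    rw [hc₀, DivisorClass.degree_mk, Divisor.degree_single, PlaceOver.isRational_of_isAlgClosed P₀]; simp
  have hσ₀ : σ • c₀ = c₀ := by
    rw [hc₀, smul_divisorClassMk, Finsupp.comapSMul_single, hP₀]
  refine Nat.card_congr
    { toFun := fun c => ⟨c.1 - n • c₀, ?_, ?_⟩
      invFun := fun c => ⟨c.1 + n • c₀, ?_, ?_⟩
      left_inv := fun c => Subtype.ext (sub_add_cancel _ _)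
      right_inv := fun c => Subtype.ext (add_sub_cancel_right _ _) }
  · rw [map_sub, map_zsmul, c.2.1, hdeg₀, smul_eq_mul, mul_one, sub_self]
  · rw [smul_sub, smul_comm σ n c₀, hσ₀, c.2.2]
  · rw [map_add, map_zsmul, c.2.1, hdeg₀, smul_eq_mul, mul_one, zero_add]
  · rw [smul_add, smul_comm σ n c₀, hσ₀, c.2.2]

end Classes

/-! ### `A_n^σ (q - 1) = h^σ (q^{n+1-g} - 1)` for `n > 2g - 2` -/

section Count

variable [IsAlgFunctionField Ω F] [IsIntegrallyClosedIn Ω F] [IsAlgClosed Ω]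
variable {k : Type x} [Field k] [Finite k] [Algebra k Ω]
variable {σ : G} (hσ : ∀ c : Ω, σ • algebraMap Ω F c = algebraMap Ω F (c ^ Nat.card k))

include hσ

/-- **The invariant classes of large degree are finite when the invariant positive divisors are**: for
`n > 2g - 2` (so `ℓ = n + 1 - g ≥ 1` on classes of degree `n`) every invariant class of degree `n` contains an
invariant positive divisor of degree `n` (`exists_invariant_effective`). [cite: Stichtenoth2009, Prop. 5.1.3] -/
theorem finite_invariantClasses_of_finite {n : ℕ} (hn : 2 * genus Ω F < n + 2)
    (hfin : Finite {A : Divisor Ω F // 0 ≤ A ∧ σ • A = A ∧ A.degree = n}) :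
    Finite {c : DivisorClass Ω F // DivisorClass.degree c = n ∧ σ • c = c} := by
  refine Finite.of_surjective
    (fun A : {A : Divisor Ω F // 0 ≤ A ∧ σ • A = A ∧ A.degree = n} =>
      (⟨DivisorClass.mk A.1, by rw [DivisorClass.degree_mk, A.2.2.2],
        by rw [smul_divisorClassMk, A.2.2.1]⟩ : {c : DivisorClass Ω F // DivisorClass.degree c = n ∧ σ • c = c}))
    ?_
  rintro ⟨c, hc, hσc⟩
  induction c using QuotientAddGroup.induction_on with
  | H D₀ =>
    rw [DivisorClass.degree_mk] at hc
    obtain ⟨g, hg0, hg⟩ := (smul_mk_eq_mk_iff σ D₀).1 hσc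
    have hℓ : 0 < ell (K := Ω) D₀ := by
      have h1 := ell_eq_degree_add_one_sub_genus (K := Ω) (F := F) (A := D₀) (by rw [hc]; omega)
      rw [hc] at h1
      omega
    obtain ⟨A, hA, hAD, hσA⟩ := exists_invariant_effective (k := k) hσ D₀ hg0 hg hℓ
    refine ⟨⟨A, hA, hσA, by rw [Divisor.degree_eq_of_isLinearlyEquivalent hAD, hc]⟩, Subtype.ext ?_⟩
    exact DivisorClass.mk_eq_mk_iff.2 hAD

/-- **`A_n^σ · (q - 1) = h_n^σ · (q^{n+1-g} - 1)` for `n > 2g - 2`** (`A_n^σ` = number of `σ`-invariant positive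
divisors of degree `n`, `h_n^σ` = number of `σ`-invariant classes of degree `n`): the class map is onto the
invariant classes, and its fibre over `[D₀]` is counted by `natCard_invariant_effective_mul` with
`ℓ(D₀) = n + 1 - g` (Riemann–Roch, `ell_eq_degree_add_one_sub_genus`).  Stichtenoth Lemma 5.1.4 (c) for the
pair `(F, σ)`. [cite: Stichtenoth2009, Lemma 5.1.4 (c)] [cite: Milne1986JacobianVarieties, §11 (proof of Thm. 11.1)] -/
theorem natCard_invariant_effective_degree_mul {n : ℕ} (hn : 2 * genus Ω F < n + 2)
    (hfin : Finite {A : Divisor Ω F // 0 ≤ A ∧ σ • A = A ∧ A.degree = n}) :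
    ((Nat.card k : ℤ) - 1) * Nat.card {A : Divisor Ω F // 0 ≤ A ∧ σ • A = A ∧ A.degree = n} =
      Nat.card {c : DivisorClass Ω F // DivisorClass.degree c = n ∧ σ • c = c} *
        ((Nat.card k : ℤ) ^ (n + 1 - genus Ω F) - 1) := by
  set T := {A : Divisor Ω F // 0 ≤ A ∧ σ • A = A ∧ A.degree = n} with hT
  set Cl := {c : DivisorClass Ω F // DivisorClass.degree c = n ∧ σ • c = c} with hCl
  haveI : Finite T := hfin
  haveI : Finite Cl := finite_invariantClasses_of_finite (k := k) hσ hn hfin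
  haveI : Fintype T := Fintype.ofFinite T
  haveI : Fintype Cl := Fintype.ofFinite Cl
  -- the class map
  let π : T → Cl := fun A => ⟨DivisorClass.mk A.1, by rw [DivisorClass.degree_mk, A.2.2.2],
    by rw [smul_divisorClassMk, A.2.2.1]⟩
  -- each fibre
  have hfib : ∀ c : Cl, ((Nat.card k : ℤ) - 1) * Fintype.card {A : T // π A = c} =
      (Nat.card k : ℤ) ^ (n + 1 - genus Ω F) - 1 := by
    rintro ⟨c, hc, hσc⟩
    induction c using QuotientAddGroup.induction_on with
    | H D₀ =>
      rw [DivisorClass.degree_mk] at hc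
      obtain ⟨g, hg0, hg⟩ := (smul_mk_eq_mk_iff σ D₀).1 hσc
      have hℓ : ell (K := Ω) D₀ = n + 1 - genus Ω F := by
        have h1 := ell_eq_degree_add_one_sub_genus (K := Ω) (F := F) (A := D₀) (by rw [hc]; omega)
        rw [hc] at h1
        omega
      rw [← hℓ, ← natCard_invariant_effective_mul (k := k) hσ D₀ hg0 hg, Fintype.card_eq_nat_card]
      congr 2
      refine Nat.card_congr ?_
      refine
        { toFun := fun A => ⟨A.1.1, A.1.2.1, DivisorClass.mk_eq_mk_iff.mp (congrArg Subtype.val A.2), A.1.2.2.1⟩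
          invFun := fun A => ⟨⟨A.1, A.2.1, A.2.2.2, ?_⟩, Subtype.ext (DivisorClass.mk_eq_mk_iff.mpr A.2.2.1)⟩
          left_inv := fun A => rfl
          right_inv := fun A => rfl }
      rw [Divisor.degree_eq_of_isLinearlyEquivalent A.2.2.1, hc]
  have hsum : Fintype.card T = ∑ c : Cl, Fintype.card {A : T // π A = c} := by
    rw [← Fintype.card_sigma]
    exact Fintype.card_congr (Equiv.sigmaFiberEquiv π).symm
  rw [← Fintype.card_eq_nat_card (α := T), hsum, Nat.cast_sum, Finset.mul_sum, Finset.sum_congr rfl fun c _ => hfib c,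
    Finset.sum_const, Finset.card_univ, nsmul_eq_mul, Fintype.card_eq_nat_card (α := Cl)]

end Count

end Literature.NumberTheory.GaloisRepresentations
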